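import Mathlib
import Summits.Parity.GeneralizedHardyLittlewood.Theorems.FordMaynardSieveConst01651SieveConst01651Defs

/-!
# Route `FordMaynardSieveConst01651`, target `SieveConst01651` (stmt-Parity-19185), line `sieve_decomposition`:
# the smooth/rough expansion of `H(n)` — first step towards the registered stub `stub_typeIIRegion`

K. Ford, J. Maynard, *On the theory of prime producing sieves*, arXiv:2407.14368, proof of Proposition 7.22 (p. 40;
Proposition 7.19 is the case `λ = μ`, `σ = ν`): for `n = n₁ n₂` with `P⁺(n₁) < n^σ ≤ P⁻(n₂)` one expands
`H(n) = ∑_{u ∣ n₁} ∑_{m ∣ n₂} 𝟙[u m ≤ n^γ] λ(u) g(𝐯(m; n))` — the entry point of the Type-II-region estimate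
(`stub_typeIIRegion` of skeleton `Cruxes/SieveConst01651/Lines/sieve_decomposition.lean` v20).  Here, over the objects
`pvec`/`roughPart`/`smoothPart`/`Gwt`/`Hwt` of `…SieveConst01651Defs` (VERBATIM the skeleton's), we prove for EVERY
`n ≥ 1` (rough or not):

* the smooth/rough split API: `roughPart y d * smoothPart y d = d`, its prime-factor description, coprimality, and
  `roughPart y (u m) = m`, `smoothPart y (u m) = u` for `u` `y`-smooth and `m` `y`-rough (`parts_of_mem_divisors`);
* `sum_divisors_eq_sum_smooth_rough`: `∑_{d ∣ n} f(d) = ∑_{u ∣ n₁} ∑_{m ∣ n₂} f(u m)`;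
* `Hwt_eq_sum_smooth_rough` / `Hwt_eq_sum_rough_mul_sum_moebius`: the displayed expansion of `H(n)` at
  `γ = 1/2`, `σ = ν`, `λ = μ`;
* (appended) `length_roughPart_mul_le`: `Ω(n₂) · ν ≤ 1` — the rough part has at most `1/ν` prime factors;
* (appended) `le_of_smoothPart_eq_one` / `smoothPart_eq_one_of_le` / `one_lt_smoothPart_of_lt`: `n₁ = 1` iff every prime
  of `n` is `≥ y`; a prime factor `< y` forces `n₁ > 1` (the case split `n₁ > 1 or k ≥ 2` of the proof of Prop. 7.22).

Pure elementary number theory; one helper towards one XL stub; nothing here proves the Parity summit.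
-/

noncomputable section

open Finset
open scoped Pointwise
open Literature.NumberTheory.Sieve Literature.NumberTheory.Sieve.FordMaynard

namespace Summit.Parity.GeneralizedHardyLittlewood.FordMaynardSieveConst01651SieveConst01651

/-! ### Prime factors of products of prime powers -/

/-- The prime factors of `∏_{p ∈ F} p ^ e(p)` (all `p ∈ F` prime) lie in `F`. [folklore] -/
theorem primeFactors_prod_pow_subset (F : Finset ℕ) (hF : ∀ p ∈ F, p.Prime) (e : ℕ → ℕ) :
    (∏ p ∈ F, p ^ e p).primeFactors ⊆ F := by
  intro q hq
  rw [Nat.mem_primeFactors] at hq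
  obtain ⟨hqp, hqd, -⟩ := hq
  obtain ⟨p, hp, hdvd⟩ := (hqp.prime.dvd_finsetProd_iff _).1 hqd
  have hqp' : q ∣ p := hqp.dvd_of_dvd_pow hdvd
  rwa [(Nat.prime_dvd_prime_iff_eq hqp (hF p hp)).1 hqp']

/-! ### The smooth / rough split `d = smoothPart y d * roughPart y d` -/

/-- `roughPart y d · ∏_{p ∣ d, p < y} p^{v_p(d)} = d`. [folklore] -/
theorem roughPart_mul_prod_eq (y : ℝ) {d : ℕ} (hd : d ≠ 0) :
    roughPart y d * ∏ p ∈ d.primeFactors.filter (fun p : ℕ => ¬ y ≤ (p : ℝ)), p ^ d.factorization p = d := by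
  unfold roughPart
  rw [Finset.prod_filter_mul_prod_filter_not, ← Nat.prod_primeFactors_pow_factorization hd]

/-- The rough part is never `0` and divides `d` (also for `d = 0`). [folklore] -/
theorem roughPart_ne_zero_and_dvd (y : ℝ) (d : ℕ) : roughPart y d ≠ 0 ∧ roughPart y d ∣ d := by
  refine ⟨?_, ?_⟩
  · unfold roughPart
    exact Finset.prod_ne_zero_iff.2 fun p hp =>
      pow_ne_zero _ (Nat.prime_of_mem_primeFactors (Finset.mem_filter.1 hp).1).ne_zero
  · rcases eq_or_ne d 0 with rfl | hd
    · exact dvd_zero _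
    · exact Dvd.intro _ (roughPart_mul_prod_eq y hd)

/-- The smooth part in closed form: `smoothPart y d = ∏_{p ∣ d, p < y} p^{v_p(d)}`. [folklore] -/
theorem smoothPart_eq (y : ℝ) {d : ℕ} (hd : d ≠ 0) :
    smoothPart y d = ∏ p ∈ d.primeFactors.filter (fun p : ℕ => ¬ y ≤ (p : ℝ)), p ^ d.factorization p := by
  unfold smoothPart
  exact Nat.div_eq_of_eq_mul_right (Nat.pos_of_ne_zero (roughPart_ne_zero_and_dvd y d).1)
    (roughPart_mul_prod_eq y hd).symm

/-- `roughPart y d * smoothPart y d = d`. [folklore] -/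
theorem roughPart_mul_smoothPart (y : ℝ) {d : ℕ} (hd : d ≠ 0) : roughPart y d * smoothPart y d = d := by
  rw [smoothPart_eq y hd]
  exact roughPart_mul_prod_eq y hd

/-- The smooth part of a non-zero number is non-zero. [folklore] -/
theorem smoothPart_ne_zero (y : ℝ) {d : ℕ} (hd : d ≠ 0) : smoothPart y d ≠ 0 := by
  intro h
  have := roughPart_mul_smoothPart y hd
  rw [h, mul_zero] at this
  exact hd this.symm

/-- Every prime factor of the rough part is `≥ y`. [folklore] -/
theorem le_of_mem_primeFactors_roughPart {y : ℝ} {d p : ℕ} (hp : p ∈ (roughPart y d).primeFactors) :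
    y ≤ (p : ℝ) := by
  have h := primeFactors_prod_pow_subset (d.primeFactors.filter (fun p : ℕ => y ≤ (p : ℝ)))
    (fun p hp => Nat.prime_of_mem_primeFactors (Finset.mem_filter.1 hp).1) (fun p => d.factorization p)
  exact (Finset.mem_filter.1 (h hp)).2

/-- Every prime factor of the smooth part is `< y`. [folklore] -/
theorem lt_of_mem_primeFactors_smoothPart {y : ℝ} {d p : ℕ} (hd : d ≠ 0)
    (hp : p ∈ (smoothPart y d).primeFactors) : (p : ℝ) < y := by
  rw [smoothPart_eq y hd] at hp
  have h := primeFactors_prod_pow_subset (d.primeFactors.filter (fun p : ℕ => ¬ y ≤ (p : ℝ)))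
    (fun p hp => Nat.prime_of_mem_primeFactors (Finset.mem_filter.1 hp).1) (fun p => d.factorization p)
  exact not_le.1 (Finset.mem_filter.1 (h hp)).2

/-- The smooth and rough parts are coprime. [folklore] -/
theorem coprime_smoothPart_roughPart (y : ℝ) {d : ℕ} (hd : d ≠ 0) :
    Nat.Coprime (smoothPart y d) (roughPart y d) := by
  rw [← Nat.disjoint_primeFactors (smoothPart_ne_zero y hd) (roughPart_ne_zero_and_dvd y d).1]
  exact Finset.disjoint_left.2 fun p hp1 hp2 =>
    (not_le.2 (lt_of_mem_primeFactors_smoothPart hd hp1)) (le_of_mem_primeFactors_roughPart hp2)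

/-- **Rough part of a smooth × rough product**: if every prime of `u` is `< y` and every prime of `m` is
`≥ y` then `roughPart y (u m) = m`. [folklore] -/
theorem roughPart_mul_of_smooth_rough {y : ℝ} {u m : ℕ} (hu : u ≠ 0) (hm : m ≠ 0)
    (hus : ∀ p ∈ u.primeFactors, (p : ℝ) < y) (hmr : ∀ p ∈ m.primeFactors, y ≤ (p : ℝ)) :
    roughPart y (u * m) = m := by
  unfold roughPart
  have hfilt : (u * m).primeFactors.filter (fun p : ℕ => y ≤ (p : ℝ)) = m.primeFactors := by
    rw [Nat.primeFactors_mul hu hm, Finset.filter_union]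
    have h1 : u.primeFactors.filter (fun p : ℕ => y ≤ (p : ℝ)) = ∅ :=
      Finset.filter_eq_empty_iff.2 fun p hp => not_le.2 (hus p hp)
    have h2 : m.primeFactors.filter (fun p : ℕ => y ≤ (p : ℝ)) = m.primeFactors :=
      Finset.filter_true_of_mem fun p hp => hmr p hp
    rw [h1, h2, Finset.empty_union]
  rw [hfilt]
  have hfac : ∀ p ∈ m.primeFactors, (u * m).factorization p = m.factorization p := by
    intro p hp
    rw [Nat.factorization_mul hu hm, Finsupp.add_apply]
    have h0 : u.factorization p = 0 := by
      apply Nat.factorization_eq_zero_of_not_dvd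
      intro hdvd
      have hpu : p ∈ u.primeFactors := Nat.mem_primeFactors.2 ⟨Nat.prime_of_mem_primeFactors hp, hdvd, hu⟩
      exact absurd (hmr p hp) (not_le.2 (hus p hpu))
    rw [h0, zero_add]
  rw [Finset.prod_congr rfl fun p hp => by rw [hfac p hp]]
  exact (Nat.prod_primeFactors_pow_factorization hm).symm

/-- **Smooth part of a smooth × rough product**: `smoothPart y (u m) = u`. [folklore] -/
theorem smoothPart_mul_of_smooth_rough {y : ℝ} {u m : ℕ} (hu : u ≠ 0) (hm : m ≠ 0)
    (hus : ∀ p ∈ u.primeFactors, (p : ℝ) < y) (hmr : ∀ p ∈ m.primeFactors, y ≤ (p : ℝ)) :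
    smoothPart y (u * m) = u := by
  unfold smoothPart
  rw [roughPart_mul_of_smooth_rough hu hm hus hmr]
  exact Nat.mul_div_cancel u (Nat.pos_of_ne_zero hm)

/-! ### Divisor sums split along the smooth / rough factorisation -/

/-- `∑_{d ∣ ab} f(d) = ∑_{u ∣ a} ∑_{m ∣ b} f(um)` for coprime `a, b`. [folklore] -/
theorem sum_divisors_mul_of_coprime {a b : ℕ} (hab : Nat.Coprime a b) (f : ℕ → ℝ) :
    ∑ d ∈ (a * b).divisors, f d = ∑ u ∈ a.divisors, ∑ m ∈ b.divisors, f (u * m) := by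
  rw [Nat.divisors_mul, ← Finset.image_mul_product, Finset.sum_image, Finset.sum_product]
  intro p hp q hq h
  exact hab.mul_injOn_divisors hp hq h

/-- `∑_{d ∣ n} f(d) = ∑_{u ∣ n₁} ∑_{m ∣ n₂} f(um)` with `n₁ = smoothPart y n`, `n₂ = roughPart y n`. [folklore] -/
theorem sum_divisors_eq_sum_smooth_rough (y : ℝ) {n : ℕ} (hn : n ≠ 0) (f : ℕ → ℝ) :
    ∑ d ∈ n.divisors, f d =
      ∑ u ∈ (smoothPart y n).divisors, ∑ m ∈ (roughPart y n).divisors, f (u * m) := by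
  have h := roughPart_mul_smoothPart y hn
  calc ∑ d ∈ n.divisors, f d = ∑ d ∈ (smoothPart y n * roughPart y n).divisors, f d := by
        rw [mul_comm, h]
    _ = _ := sum_divisors_mul_of_coprime (coprime_smoothPart_roughPart y hn) f

/-- A divisor of the smooth part of `n` at `y` has all its primes `< y`, a divisor of the rough part all its
primes `≥ y`; hence `smoothPart y (u m) = u`, `roughPart y (u m) = m`. [folklore] -/
theorem parts_of_mem_divisors {y : ℝ} {n u m : ℕ} (hn : n ≠ 0) (hu : u ∈ (smoothPart y n).divisors)
    (hm : m ∈ (roughPart y n).divisors) :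
    smoothPart y (u * m) = u ∧ roughPart y (u * m) = m := by
  have hu0 : u ≠ 0 := (Nat.pos_of_mem_divisors hu).ne'
  have hm0 : m ≠ 0 := (Nat.pos_of_mem_divisors hm).ne'
  have hus : ∀ p ∈ u.primeFactors, (p : ℝ) < y := fun p hp =>
    lt_of_mem_primeFactors_smoothPart hn
      (Nat.primeFactors_mono (Nat.dvd_of_mem_divisors hu) (smoothPart_ne_zero y hn) hp)
  have hmr : ∀ p ∈ m.primeFactors, y ≤ (p : ℝ) := fun p hp =>
    le_of_mem_primeFactors_roughPart (Nat.primeFactors_mono (Nat.dvd_of_mem_divisors hm) (roughPart_ne_zero_and_dvd y n).1 hp)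
  exact ⟨smoothPart_mul_of_smooth_rough hu0 hm0 hus hmr, roughPart_mul_of_smooth_rough hu0 hm0 hus hmr⟩

/-! ### The expansion of `H(n)` (first step of Ford–Maynard's proof of Proposition 7.19 / 7.22) -/

/-- **`H(n)` expanded along the smooth/rough split** (Ford–Maynard, proof of Proposition 7.22, p. 40, at
`λ = μ`, `σ = ν`, `γ = 1/2`): with `n₁ = smoothPart n^ν n`, `n₂ = roughPart n^ν n`,
`H(n) = ∑_{u ∣ n₁} ∑_{m ∣ n₂} 𝟙[u m ≤ n^{1/2}] μ(u) g(𝐯(m; n))` — every `n ≥ 1`, rough or not.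
[cite: FordMaynard2024PrimeSieves, proof of Proposition 7.22 (expansion of H(n))] -/
theorem Hwt_eq_sum_smooth_rough (g : VecFn) (ν : ℝ) {n : ℕ} (hn : n ≠ 0) :
    Hwt g ν n = ∑ u ∈ (smoothPart ((n : ℝ) ^ ν) n).divisors, ∑ m ∈ (roughPart ((n : ℝ) ^ ν) n).divisors,
      if ((u * m : ℕ) : ℝ) ≤ (n : ℝ) ^ (1 / 2 : ℝ) then
        ((ArithmeticFunction.moebius u : ℤ) : ℝ) * g _ (pvec n m) else 0 := by
  unfold Hwt
  rw [sum_divisors_eq_sum_smooth_rough ((n : ℝ) ^ ν) hn]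
  refine Finset.sum_congr rfl fun u hu => Finset.sum_congr rfl fun m hm => ?_
  obtain ⟨hs, hr⟩ := parts_of_mem_divisors hn hu hm
  unfold Gwt
  rw [hs, hr]

/-- The same expansion with the rough divisor outermost:
`H(n) = ∑_{m ∣ n₂} g(𝐯(m; n)) · ∑_{u ∣ n₁, u m ≤ n^{1/2}} μ(u)`. [cite: FordMaynard2024PrimeSieves, proof of Proposition 7.22 (expansion of H(n)) and Lemma 7.18 (a)] -/
theorem Hwt_eq_sum_rough_mul_sum_moebius (g : VecFn) (ν : ℝ) {n : ℕ} (hn : n ≠ 0) :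
    Hwt g ν n = ∑ m ∈ (roughPart ((n : ℝ) ^ ν) n).divisors, g _ (pvec n m) *
      ∑ u ∈ (smoothPart ((n : ℝ) ^ ν) n).divisors,
        if ((u * m : ℕ) : ℝ) ≤ (n : ℝ) ^ (1 / 2 : ℝ) then ((ArithmeticFunction.moebius u : ℤ) : ℝ) else 0 := by
  rw [Hwt_eq_sum_smooth_rough g ν hn, Finset.sum_comm]
  refine Finset.sum_congr rfl fun m _ => ?_
  rw [Finset.mul_sum]
  refine Finset.sum_congr rfl fun u _ => ?_
  split_ifs <;> ring

end Summit.Parity.GeneralizedHardyLittlewood.FordMaynardSieveConst01651SieveConst01651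


namespace Summit.Parity.GeneralizedHardyLittlewood.FordMaynardSieveConst01651SieveConst01651

/-! ### The rough part has at most `1/ν` prime factors (appended) -/

/-- **`Ω(n₂) · ν ≤ 1`** for the rough part `n₂ = roughPart n^ν n` of `n ≥ 2` (any real `ν`): every prime factor of `n₂`,
with multiplicity, is `≥ n^ν` and `n₂ ≤ n` ("`n₂` has at most `1/σ` prime factors", Ford–Maynard, proof of
Proposition 7.22). [cite: FordMaynard2024PrimeSieves, proof of Proposition 7.22] -/
theorem length_roughPart_mul_le (ν : ℝ) {n : ℕ} (hn : 2 ≤ n) :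
    ((roughPart ((n : ℝ) ^ ν) n).primeFactorsList.length : ℝ) * ν ≤ 1 := by
  set y : ℝ := (n : ℝ) ^ ν with hy
  set m : ℕ := roughPart y n with hm
  have hn0 : n ≠ 0 := by omega
  have hn1 : (1 : ℝ) < n := by exact_mod_cast hn
  have hnpos : (0 : ℝ) < n := by positivity
  have hy0 : 0 ≤ y := Real.rpow_nonneg hnpos.le ν
  have hm0 : m ≠ 0 := (roughPart_ne_zero_and_dvd y n).1
  have hmle : (m : ℝ) ≤ n := by exact_mod_cast Nat.le_of_dvd (Nat.pos_of_ne_zero hn0) (roughPart_ne_zero_and_dvd y n).2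
  -- every listed prime factor of `m` is `≥ y`
  have hfac : ∀ p ∈ m.primeFactorsList, y ≤ (p : ℝ) := fun p hp =>
    le_of_mem_primeFactors_roughPart (d := n) (Nat.mem_primeFactors_iff_mem_primeFactorsList.2 hp)
  have hpow : y ^ m.primeFactorsList.length ≤ (m : ℝ) := by
    -- `y ^ length ≤ product` for a list of naturals each `≥ y` (cf. the tree's `LenstraPomerance.pow_le_cast_prod`)
    have key : ∀ l : List ℕ, (∀ p ∈ l, y ≤ (p : ℝ)) → y ^ l.length ≤ ((l.prod : ℕ) : ℝ) := by
      intro l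
      induction l with
      | nil => intro _; simp
      | cons p l ih =>
          intro h
          rw [List.length_cons, pow_succ, List.prod_cons, Nat.cast_mul, mul_comm]
          exact mul_le_mul (h p (by simp)) (ih fun q hq => h q (by simp [hq])) (pow_nonneg hy0 _)
            (Nat.cast_nonneg _)
    have := key m.primeFactorsList hfac
    rwa [Nat.prod_primeFactorsList hm0] at this
  -- `y ^ k = n ^ (ν k) ≤ n = n ^ 1`
  have hk : (n : ℝ) ^ (ν * m.primeFactorsList.length) ≤ (n : ℝ) ^ (1 : ℝ) := by
    rw [Real.rpow_mul hnpos.le, Real.rpow_natCast, Real.rpow_one]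
    exact hpow.trans hmle
  have := (Real.rpow_le_rpow_left_iff hn1).1 hk
  rw [mul_comm] at this
  exact this

end Summit.Parity.GeneralizedHardyLittlewood.FordMaynardSieveConst01651SieveConst01651


namespace Summit.Parity.GeneralizedHardyLittlewood.FordMaynardSieveConst01651SieveConst01651

/-! ### `smoothPart y n = 1` iff every prime factor of `n` is `≥ y` (appended) -/

/-- If the `y`-smooth part of `n ≥ 1` is trivial then every prime factor of `n` is `≥ y` (so `n` is its own rough
part). [folklore] -/
theorem le_of_smoothPart_eq_one {y : ℝ} {n : ℕ} (hn : n ≠ 0) (h1 : smoothPart y n = 1) :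
    roughPart y n = n ∧ ∀ p ∈ n.primeFactors, y ≤ (p : ℝ) := by
  have hmul := roughPart_mul_smoothPart y hn
  rw [h1, mul_one] at hmul
  refine ⟨hmul, fun p hp => le_of_mem_primeFactors_roughPart (d := n) ?_⟩
  rwa [hmul]

/-- Conversely, if every prime factor of `n ≥ 1` is `≥ y` then `smoothPart y n = 1` and `roughPart y n = n`.
[folklore] -/
theorem smoothPart_eq_one_of_le {y : ℝ} {n : ℕ} (hn : n ≠ 0) (h : ∀ p ∈ n.primeFactors, y ≤ (p : ℝ)) :
    smoothPart y n = 1 ∧ roughPart y n = n := by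
  have hs := smoothPart_mul_of_smooth_rough (y := y) one_ne_zero hn (by simp) h
  have hr := roughPart_mul_of_smooth_rough (y := y) one_ne_zero hn (by simp) h
  rw [one_mul] at hs hr
  exact ⟨hs, hr⟩

/-- If some prime factor of `n ≥ 1` is `< y` then the smooth part is `> 1` (the case "`n₁ > 1`" of Ford–Maynard's
proof of Proposition 7.22). [cite: FordMaynard2024PrimeSieves, proof of Proposition 7.22] -/
theorem one_lt_smoothPart_of_lt {y : ℝ} {n p : ℕ} (hn : n ≠ 0) (hp : p ∈ n.primeFactors) (hpy : (p : ℝ) < y) :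
    1 < smoothPart y n := by
  have hs0 := smoothPart_ne_zero y hn
  by_contra hle
  have h1 : smoothPart y n = 1 := by omega
  exact absurd ((le_of_smoothPart_eq_one hn h1).2 p hp) (not_le.2 hpy)

end Summit.Parity.GeneralizedHardyLittlewood.FordMaynardSieveConst01651SieveConst01651

end
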